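import Summits.KontsevichZagierPeriods.KontsevichZagierPeriods.Theorems.IsogenyCertificatesXMapKernelStubDatumOfRatMult
import Summits.KontsevichZagierPeriods.KontsevichZagierPeriods.Theorems.IsogenyCertificatesXMapKernelStubHuberWustholzSplitting
import Literature.FieldTheory.AlgClosed.AutFixedSubfield
import Mathlib.FieldTheory.AlgebraicClosure
import Mathlib.Algebra.AlgebraicCard

/-!
# `AlgebraicModuliRealPeriodCell`, line `Sketch` — stub **Ib**: real lattice multiplier ⇒ datum

Support file for the crux `IsogenyCertificates.AlgebraicModuliRealPeriodCell`
(stmt-KontsevichZagierPeriods-18265), line `Sketch`, stub `stub_algDatumOfRealMult` (Ib: a non-zero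
REAL analytic isogeny between the period lattices of two nonsingular cubics `y² = x³ + αx + β`,
`y² = x³ + α'x + β'` with real algebraic coefficients is realised by an x-rational isogeny datum
`(f, g, c)` with coefficients in `ℚ̄ ∩ ℝ`). It is the port of the `ℚ`-line's
`XMapKernelStubDatumOfRatMult` (rational multiplier `k`, integral moduli) one field up; the new
point is that the multiplier `ν` may be irrational (calibration: `y² = x³ + 1 → y² = x³ − 1`,
`ν = √3`-type data), so the transformation polynomials are descended not to `ℚ(X)` but to
`(ℚ̄ ∩ ℝ)(X)`.

**Statement.** Let `α, β, α', β' ∈ ℚ̄ ∩ ℝ`, `Λ`, `Λ'` period lattices with `g₂ = −4α, g₃ = −4β`,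
`g₂' = −4α', g₃' = −4β'` (normalisation `℘ = x`, `℘' = 2y`), and `ν ∈ ℝˣ` with `νΛ ⊆ Λ'`. Then
there are `f, g ∈ ℝ[X]`, `c ∈ ℝ`, all coefficients algebraic over `ℚ`, with
`W := f'g − fg' ≠ 0` and `c²·g·(f³ + α'fg² + β'g³) = (X³ + αX + β)·W²`.

**Proof.** `Λ ⊆ ν⁻¹Λ' =: Λ″` (`PeriodPair.mulLeft`) with `g₂(Λ″) = ν⁴g₂' = −4ν⁴α'`,
`g₃(Λ″) = −4ν⁶β'`. The multiplier `ν` is algebraic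
(`HuberWustholzSplitting.isAlgebraic_of_mul_mem_lattice`), so all four invariants
`g₂, g₃, g₂″, g₃″` are real algebraic numbers. The tree gives `℘_{Λ″}·Q(℘_Λ) = P(℘_Λ)` with
`P, Q ∈ ℂ[X]` (`exists_polynomial_weierstrassP_mul_eval_eq_of_le`, Lawden §9.8) and the rigidity
`P^σ·Q = P·Q^σ` for every field automorphism `σ` of `ℂ` fixing the four invariants
(`map_mul_eq_mul_map_of_weierstrassP_mul_eval_eq`, Cox §10.C). **Descent**
(`exists_real_map_of_forall_map_mul_eq`, the `ℚ̄ ∩ ℝ` form of the tree's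
`Polynomial.exists_rat_map_of_forall_map_mul_eq`): reducing `P/Q = P₀/Q₀` to lowest terms with
`Q₀` monic, every such `σ` fixes `P₀, Q₀` coefficientwise; a coefficient `z` is then fixed by
`Aut(ℂ/ℚ̄)` (the invariants lie in the countable field `ℚ̄ ⊂ ℂ`), hence `z ∈ ℚ̄`
(`Complex.mem_subfield_of_forall_ringEquiv`, Lang *Algebra* VIII §1), and by complex conjugation
(the invariants are real), hence `z ∈ ℝ`; so `P₀, Q₀` lift to `f₀, g₀ ∈ ℝ[X]` with algebraic
coefficients. Then, exactly as over `ℚ`: `Q₀(℘_Λ) ≠ 0`, `℘_{Λ″}Q₀(℘_Λ) = P₀(℘_Λ)`,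
`deg g₀ < deg f₀` (`natDegree_lt_of_weierstrassP_mul_eval_eq`), the certificate
`transformation_polynomial_identity` pulled back along `ℝ[X] ↪ ℂ[X]` and divided by `4` reads
`W₀²·(X³ + αX + β) = g₀·(f₀³ + ν⁴α'f₀g₀² + ν⁶β'g₀³)`, and the datum is `f := f₀`, `g := ν²g₀`,
`c := ν`, with `W = ν²W₀ ≠ 0` by the `ℚ`-line's generic `DatumOfRatMult.wronskian_ne_zero`
(coprime, `deg g₀ < deg f₀`).

The nonsingularity hypotheses of the registered signature are not needed by the argument. No new
definitions; no named facts are used.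

References: Silverman, *The Arithmetic of Elliptic Curves* (2009), Thm. VI.4.1, VI.5.3;
Cox, *Primes of the form x² + ny²* (2013), §10.C; Lang, *Algebra* (2002), Ch. VIII §1.
-/

noncomputable section

namespace Summit.KontsevichZagierPeriods.IsogenyCertificates.AlgRealPeriodCell.DatumOfRealMult

open Polynomial Cardinal
open scoped PeriodPair ComplexConjugate
open Literature.FieldTheory.AlgClosed
open Summit.KontsevichZagierPeriods.IsogenyCertificates.XMapKernelStubs.DatumOfRatMult
  (wronskian_ne_zero)
open Summit.KontsevichZagierPeriods.IsogenyCertificates.XMapKernelStubs.HuberWustholzSplitting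
  (isAlgebraic_of_mul_mem_lattice)

/-! ## §1 Descent of a rational function fixed by `Aut(ℂ/S)`, `S ⊆ ℚ̄ ∩ ℝ`, to `(ℚ̄ ∩ ℝ)(X)` -/

/-- `-4x` is algebraic when `x` is. [folklore] -/
theorem isAlgebraic_neg_four_mul {A : Type*} [Field A] [Algebra ℚ A] {x : A}
    (hx : IsAlgebraic ℚ x) : IsAlgebraic ℚ (-4 * x) := by
  have h := (isAlgebraic_rat ℚ (-4 : ℚ) (A := A)).mul hx
  simpa using h

/-- **A complex number fixed by every automorphism of `ℂ` fixing a set `S ⊆ ℚ̄ ∩ ℝ` pointwise is a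
real algebraic number.** Algebraic: an automorphism fixing the countable subfield `ℚ̄ ⊂ ℂ`
pointwise fixes `S`, hence `z`, and the fixed field of `Aut(ℂ/ℚ̄)` is `ℚ̄`
(`Complex.mem_subfield_of_forall_ringEquiv`); real: complex conjugation fixes `S`, hence `z`.
(Lang, *Algebra*, Ch. VIII §1.) [cite: Lang2002, Ch. VIII §1] -/
theorem isAlgebraic_and_real_of_forall_ringEquiv (S : Set ℂ)
    (hS : ∀ s ∈ S, IsAlgebraic ℚ s ∧ ∃ r : ℝ, (r : ℂ) = s) {z : ℂ}
    (hz : ∀ σ : ℂ ≃+* ℂ, (∀ s ∈ S, σ s = s) → σ z = z) :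
    IsAlgebraic ℚ z ∧ ∃ r : ℝ, (r : ℂ) = z := by
  refine ⟨?_, ?_⟩
  · have hF : #((algebraicClosure ℚ ℂ).toSubfield) ≤ ℵ₀ := by
      refine Set.Countable.le_aleph0 (s := ((algebraicClosure ℚ ℂ).toSubfield : Set ℂ)) ?_
      exact (Algebraic.countable ℚ ℂ).mono fun x hx ↦ mem_algebraicClosure_iff.1
        ((IntermediateField.mem_toSubfield _ _).1 (SetLike.mem_coe.1 hx))
    have hmem : z ∈ (algebraicClosure ℚ ℂ).toSubfield :=
      Complex.mem_subfield_of_forall_ringEquiv _ hF fun σ hσ ↦ hz σ fun s hs ↦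
        hσ s ((IntermediateField.mem_toSubfield _ _).2 (mem_algebraicClosure_iff.2 (hS s hs).1))
    exact mem_algebraicClosure_iff.1 ((IntermediateField.mem_toSubfield _ _).1 hmem)
  · have hc : conj z = z := by
      have h := hz (starRingAut : ℂ ≃+* ℂ) fun s hs ↦ by
        obtain ⟨r, hr⟩ := (hS s hs).2
        rw [starRingAut_apply, Complex.star_def, ← hr, Complex.conj_ofReal]
      rwa [starRingAut_apply, Complex.star_def] at h
    exact ⟨z.re, Complex.conj_eq_iff_re.1 hc⟩

/-- **Descent of an `Aut(ℂ/S)`-invariant rational function to `(ℚ̄ ∩ ℝ)(X)`.** Let `P, Q ∈ ℂ[X]`,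
`Q ≠ 0`, let `S ⊆ ℂ` consist of real algebraic numbers, and suppose `P^σ·Q = P·Q^σ` (i.e.
`(P/Q)^σ = P/Q`) for every field automorphism `σ` of `ℂ` fixing `S` pointwise. Then
`P·g₀ = f₀·Q` (i.e. `P/Q = f₀/g₀`) for coprime `f₀, g₀ ∈ ℝ[X]` with `g₀` monic and all
coefficients algebraic over `ℚ`. Proof: reduce `P/Q = P₂/Q₂` with `P₂, Q₂` coprime, `Q₂` monic;
then `Q₂ ∣ Q₂^σ ∣ Q₂`, so `Q₂^σ = Q₂` and `P₂^σ = P₂` for every such `σ`; every coefficient is thus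
real algebraic (`isAlgebraic_and_real_of_forall_ringEquiv`), and the pair lifts to `ℝ[X]`
(`Polynomial.lifts`). The `ℚ` case (`S = ∅`) is the tree's
`Polynomial.exists_rat_map_of_forall_map_mul_eq` (Cox, proof of Thm. 10.23).
[cite: Cox2013, §10.C proof of Thm. 10.23] -/
theorem exists_real_map_of_forall_map_mul_eq {P Q : ℂ[X]} (hQ0 : Q ≠ 0) (S : Set ℂ)
    (hS : ∀ s ∈ S, IsAlgebraic ℚ s ∧ ∃ r : ℝ, (r : ℂ) = s)
    (h : ∀ σ : ℂ ≃+* ℂ, (∀ s ∈ S, σ s = s) →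
      P.map (σ : ℂ →+* ℂ) * Q = P * Q.map (σ : ℂ →+* ℂ)) :
    ∃ f₀ g₀ : ℝ[X], g₀.Monic ∧ IsCoprime f₀ g₀ ∧ (∀ n, IsAlgebraic ℚ (f₀.coeff n)) ∧
      (∀ n, IsAlgebraic ℚ (g₀.coeff n)) ∧
      P * g₀.map (algebraMap ℝ ℂ) = f₀.map (algebraMap ℝ ℂ) * Q := by
  classical
  -- reduce the fraction `P/Q` (as in `Polynomial.exists_rat_map_of_forall_map_mul_eq`)
  set g : ℂ[X] := GCDMonoid.gcd P Q with hg
  have hg0 : g ≠ 0 := gcd_ne_zero_of_right hQ0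
  set P₁ : ℂ[X] := P / g with hP₁def
  set Q₁ : ℂ[X] := Q / g with hQ₁def
  have hP₁ : g * P₁ = P := EuclideanDomain.mul_div_cancel' hg0 (GCDMonoid.gcd_dvd_left P Q)
  have hQ₁ : g * Q₁ = Q := EuclideanDomain.mul_div_cancel' hg0 (GCDMonoid.gcd_dvd_right P Q)
  have hcop₁ : IsCoprime P₁ Q₁ := isCoprime_div_gcd_div_gcd hQ0
  have hQ₁0 : Q₁ ≠ 0 := by
    intro h0; apply hQ0; rw [← hQ₁, h0, mul_zero]
  set u : ℂ := Q₁.leadingCoeff with hu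
  have hu0 : u ≠ 0 := leadingCoeff_ne_zero.mpr hQ₁0
  set Q₂ : ℂ[X] := Q₁ * C u⁻¹ with hQ₂
  set P₂ : ℂ[X] := P₁ * C u⁻¹ with hP₂
  have hQ₂m : Q₂.Monic := monic_mul_leadingCoeff_inv hQ₁0
  have hunit : IsUnit (C u⁻¹) := isUnit_C.mpr (IsUnit.mk0 _ (inv_ne_zero hu0))
  have hcop₂ : IsCoprime P₂ Q₂ := (isCoprime_mul_unit_right hunit P₁ Q₁).mpr hcop₁
  have hrel : P * Q₂ = P₂ * Q := by
    simp only [hQ₂, hP₂]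
    rw [← hP₁, ← hQ₁]
    ring
  -- the reduced pair is fixed by every `σ` fixing `S`
  have hinv : ∀ σ : ℂ ≃+* ℂ, (∀ s ∈ S, σ s = s) →
      P₂.map (σ : ℂ →+* ℂ) = P₂ ∧ Q₂.map (σ : ℂ →+* ℂ) = Q₂ := by
    intro σ hσ
    have hσinj : Function.Injective (σ : ℂ →+* ℂ) := σ.injective
    have e3 := h σ hσ
    have e2 : P.map (σ : ℂ →+* ℂ) * Q₂.map (σ : ℂ →+* ℂ) =
        P₂.map (σ : ℂ →+* ℂ) * Q.map (σ : ℂ →+* ℂ) := by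
      rw [← Polynomial.map_mul, hrel, Polynomial.map_mul]
    have hQσ0 : Q.map (σ : ℂ →+* ℂ) ≠ 0 := (Polynomial.map_ne_zero_iff hσinj).mpr hQ0
    have e4 : P₂ * Q₂.map (σ : ℂ →+* ℂ) = P₂.map (σ : ℂ →+* ℂ) * Q₂ := by
      refine mul_right_cancel₀ (mul_ne_zero hQ0 hQσ0) ?_
      linear_combination (-(Q₂.map (σ : ℂ →+* ℂ) * Q.map (σ : ℂ →+* ℂ))) * hrel
        + (-(Q₂ * Q₂.map (σ : ℂ →+* ℂ))) * e3 + (Q₂ * Q) * e2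
    have hQ₂σm : (Q₂.map (σ : ℂ →+* ℂ)).Monic := hQ₂m.map _
    have hcopσ : IsCoprime (P₂.map (σ : ℂ →+* ℂ)) (Q₂.map (σ : ℂ →+* ℂ)) :=
      (isCoprime_map (σ : ℂ →+* ℂ)).mpr hcop₂
    have hd1 : Q₂ ∣ Q₂.map (σ : ℂ →+* ℂ) := by
      have : Q₂ ∣ P₂ * Q₂.map (σ : ℂ →+* ℂ) := by rw [e4]; exact dvd_mul_left _ _
      exact hcop₂.symm.dvd_of_dvd_mul_left this
    have hd2 : Q₂.map (σ : ℂ →+* ℂ) ∣ Q₂ := by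
      have : Q₂.map (σ : ℂ →+* ℂ) ∣ P₂.map (σ : ℂ →+* ℂ) * Q₂ := by
        rw [← e4]; exact dvd_mul_left _ _
      exact hcopσ.symm.dvd_of_dvd_mul_left this
    have hQeq : Q₂.map (σ : ℂ →+* ℂ) = Q₂ :=
      eq_of_monic_of_associated hQ₂σm hQ₂m (associated_of_dvd_dvd hd2 hd1)
    refine ⟨?_, hQeq⟩
    rw [hQeq] at e4
    exact (mul_right_cancel₀ hQ₂m.ne_zero e4).symm
  -- so its coefficients are real algebraic numbers, and the pair lifts to `ℝ[X]`
  have hcoefP : ∀ n, IsAlgebraic ℚ (P₂.coeff n) ∧ ∃ r : ℝ, (r : ℂ) = P₂.coeff n := fun n ↦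
    isAlgebraic_and_real_of_forall_ringEquiv S hS fun σ hσ ↦ by
      simpa [Polynomial.coeff_map] using congrArg (fun p ↦ p.coeff n) (hinv σ hσ).1
  have hcoefQ : ∀ n, IsAlgebraic ℚ (Q₂.coeff n) ∧ ∃ r : ℝ, (r : ℂ) = Q₂.coeff n := fun n ↦
    isAlgebraic_and_real_of_forall_ringEquiv S hS fun σ hσ ↦ by
      simpa [Polynomial.coeff_map] using congrArg (fun p ↦ p.coeff n) (hinv σ hσ).2
  have hliftP : P₂ ∈ Polynomial.lifts (algebraMap ℝ ℂ) := by
    rw [lifts_iff_coeff_lifts]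
    intro n
    obtain ⟨r, hr⟩ := (hcoefP n).2
    exact ⟨r, by simpa using hr⟩
  have hliftQ : Q₂ ∈ Polynomial.lifts (algebraMap ℝ ℂ) := by
    rw [lifts_iff_coeff_lifts]
    intro n
    obtain ⟨r, hr⟩ := (hcoefQ n).2
    exact ⟨r, by simpa using hr⟩
  obtain ⟨f₀, hf₀⟩ := (mem_lifts _).mp hliftP
  obtain ⟨g₀, hg₀, -, hg₀m⟩ := lifts_and_degree_eq_and_monic hliftQ hQ₂m
  have hinj : Function.Injective (algebraMap ℝ ℂ) := (algebraMap ℝ ℂ).injective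
  refine ⟨f₀, g₀, hg₀m, ?_, fun n ↦ ?_, fun n ↦ ?_, ?_⟩
  · rw [← isCoprime_map (algebraMap ℝ ℂ), hf₀, hg₀]
    exact hcop₂
  · have h1 := (hcoefP n).1
    rw [← hf₀, coeff_map] at h1
    exact (isAlgebraic_algebraMap_iff hinj).mp h1
  · have h1 := (hcoefQ n).1
    rw [← hg₀, coeff_map] at h1
    exact (isAlgebraic_algebraMap_iff hinj).mp h1
  · rw [hf₀, hg₀]
    exact hrel

/-! ## §2 The stub -/

/-- **Ib — a real lattice multiplier between real-algebraic curves is realised by a real-algebraic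
x-rational isogeny datum.** For real algebraic `α, β, α', β'` (nonsingular cubics), period pairs
`L, L'` with `g₂(L) = −4α, g₃(L) = −4β, g₂(L') = −4α', g₃(L') = −4β'`, and `ν ∈ ℝ`, `ν ≠ 0`,
with `ν·Λ_L ⊆ Λ_{L'}`, there are `f, g ∈ ℝ[X]`, `c ∈ ℝ` with algebraic coefficients,
`f'g − fg' ≠ 0` and `c²·g·(f³ + α'fg² + β'g³) = (X³ + αX + β)·(f'g − fg')²`: the multiplier `ν`
is algebraic (`isAlgebraic_of_mul_mem_lattice`), the transformation `℘_{ν⁻¹Λ'} = (P/Q)(℘_Λ)`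
(`exists_polynomial_weierstrassP_mul_eval_eq_of_le`) is rigid under `Aut(ℂ)` fixing the four real
algebraic invariants (`map_mul_eq_mul_map_of_weierstrassP_mul_eval_eq`), hence descends to
`f₀/g₀ ∈ (ℚ̄ ∩ ℝ)(X)` (`exists_real_map_of_forall_map_mul_eq`); the certificate
`transformation_polynomial_identity` pulled back to `ℝ[X]` gives the identity for
`f = f₀`, `g = ν²g₀`, `c = ν`, and the Wronskian is `ν²·(f₀'g₀ − f₀g₀') ≠ 0`
(`wronskian_ne_zero`, `natDegree_lt_of_weierstrassP_mul_eval_eq`). (The `x`-coordinate of the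
isogeny `ℂ/Λ → ℂ/ν⁻¹Λ'`, `z ↦ z`, is defined over `ℚ(g₂, g₃, g₂″, g₃″) ⊆ ℚ̄ ∩ ℝ`: Silverman,
*AEC*, Thm. VI.4.1 (b), VI.5.3.) [cite: SilvermanAEC2009, Thm. VI.4.1] -/
theorem stub_algDatumOfRealMult : ∀ (α β α' β' : ℝ), IsAlgebraic ℚ α → IsAlgebraic ℚ β → IsAlgebraic ℚ α' → IsAlgebraic ℚ β' → 4 * α ^ 3 + 27 * β ^ 2 ≠ 0 → 4 * α' ^ 3 + 27 * β' ^ 2 ≠ 0 → ∀ (L L' : PeriodPair) (ν : ℝ), L.g₂ = -4 * (α : ℂ) → L.g₃ = -4 * (β : ℂ) → L'.g₂ = -4 * (α' : ℂ) → L'.g₃ = -4 * (β' : ℂ) → ν ≠ 0 → (∀ l ∈ L.lattice, (ν : ℂ) * l ∈ L'.lattice) → (∃ (f g : Polynomial ℝ) (c : ℝ), (∀ n, IsAlgebraic ℚ (f.coeff n)) ∧ (∀ n, IsAlgebraic ℚ (g.coeff n)) ∧ IsAlgebraic ℚ c ∧ Polynomial.derivative f * g - f * Polynomial.derivative g ≠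 0 ∧ Polynomial.C (c ^ 2) * g * (f ^ 3 + Polynomial.C α' * f * g ^ 2 + Polynomial.C β' * g ^ 3) = (Polynomial.X ^ 3 + Polynomial.C α * Polynomial.X + Polynomial.C β) * (Polynomial.derivative f * g - f * Polynomial.derivative g) ^ 2) := by
  intro α β α' β' hα hβ hα' hβ' _ _ L L' ν hL2 hL3 hL'2 hL'3 hν hmul
  have hνC : (ν : ℂ) ≠ 0 := Complex.ofReal_ne_zero.mpr hν
  have hc : (ν : ℂ)⁻¹ ≠ 0 := inv_ne_zero hνC
  have hinj : Function.Injective (algebraMap ℝ ℂ) := (algebraMap ℝ ℂ).injective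
  -- the lattice `Λ'' = ν⁻¹ Λ' ⊇ Λ`, with invariants `ν⁴ g₂'`, `ν⁶ g₃'`
  obtain ⟨L'', hle, hg₂, hg₃⟩ : ∃ L'' : PeriodPair, L.lattice ≤ L''.lattice ∧
      L''.g₂ = (ν : ℂ) ^ 4 * (-4 * (α' : ℂ)) ∧ L''.g₃ = (ν : ℂ) ^ 6 * (-4 * (β' : ℂ)) := by
    refine ⟨L'.mulLeft (ν : ℂ)⁻¹ hc, fun x hx ↦ ?_, ?_, ?_⟩
    · rw [PeriodPair.mem_mulLeft_lattice, inv_inv]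
      exact hmul x hx
    · rw [PeriodPair.g₂_mulLeft, hL'2, inv_pow, inv_inv]
    · rw [PeriodPair.g₃_mulLeft, hL'3, inv_pow, inv_inv]
  -- the multiplier `ν` is algebraic, so the four invariants are real algebraic numbers
  have hαC : IsAlgebraic ℚ (α : ℂ) := (isAlgebraic_algebraMap_iff hinj).mpr hα
  have hβC : IsAlgebraic ℚ (β : ℂ) := (isAlgebraic_algebraMap_iff hinj).mpr hβ
  have hα'C : IsAlgebraic ℚ (α' : ℂ) := (isAlgebraic_algebraMap_iff hinj).mpr hα'
  have hβ'C : IsAlgebraic ℚ (β' : ℂ) := (isAlgebraic_algebraMap_iff hinj).mpr hβ'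
  have hL2a : IsAlgebraic ℚ L.g₂ := by rw [hL2]; exact isAlgebraic_neg_four_mul hαC
  have hL3a : IsAlgebraic ℚ L.g₃ := by rw [hL3]; exact isAlgebraic_neg_four_mul hβC
  have hL'2a : IsAlgebraic ℚ L'.g₂ := by rw [hL'2]; exact isAlgebraic_neg_four_mul hα'C
  have hL'3a : IsAlgebraic ℚ L'.g₃ := by rw [hL'3]; exact isAlgebraic_neg_four_mul hβ'C
  have hνa : IsAlgebraic ℚ (ν : ℂ) := isAlgebraic_of_mul_mem_lattice hL2a hL3a hL'2a hL'3a hνC hmul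
  have hνR : IsAlgebraic ℚ ν := (isAlgebraic_algebraMap_iff hinj).mp hνa
  set S : Set ℂ := {L.g₂, L.g₃, L''.g₂, L''.g₃} with hS_def
  have hS : ∀ s ∈ S, IsAlgebraic ℚ s ∧ ∃ r : ℝ, (r : ℂ) = s := by
    intro s hs
    simp only [hS_def, Set.mem_insert_iff, Set.mem_singleton_iff] at hs
    rcases hs with rfl | rfl | rfl | rfl
    · exact ⟨hL2a, -4 * α, by push_cast; rw [hL2]⟩
    · exact ⟨hL3a, -4 * β, by push_cast; rw [hL3]⟩
    · refine ⟨?_, ν ^ 4 * (-4 * α'), by push_cast; rw [hg₂]⟩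
      rw [hg₂]; exact (hνa.pow 4).mul (isAlgebraic_neg_four_mul hα'C)
    · refine ⟨?_, ν ^ 6 * (-4 * β'), by push_cast; rw [hg₃]⟩
      rw [hg₃]; exact (hνa.pow 6).mul (isAlgebraic_neg_four_mul hβ'C)
  -- the transformation `℘_{Λ''} = (P/Q)(℘_Λ)`, rigid under `Aut(ℂ)` fixing `S`, descended to `ℝ[X]`
  obtain ⟨P, Q, hQ0, hQ, hPQ⟩ := L.exists_polynomial_weierstrassP_mul_eval_eq_of_le L'' hle
  have hrig : ∀ σ : ℂ ≃+* ℂ, (∀ s ∈ S, σ s = s) →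
      P.map (σ : ℂ →+* ℂ) * Q = P * Q.map (σ : ℂ →+* ℂ) := fun σ hσ ↦
    L.map_mul_eq_mul_map_of_weierstrassP_mul_eval_eq L'' hle hQ0 hQ hPQ σ
      (hσ _ (by simp [hS_def])) (hσ _ (by simp [hS_def])) (hσ _ (by simp [hS_def]))
      (hσ _ (by simp [hS_def]))
  obtain ⟨f₀, g₀, hg₀m, hcop, hf₀a, hg₀a, hrel⟩ :=
    exists_real_map_of_forall_map_mul_eq hQ0 S hS hrig
  have hQ₀ : ∀ z ∉ L''.lattice, (g₀.map (algebraMap ℝ ℂ)).eval (℘[L] z) ≠ 0 := by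
    intro z hz h0
    have hrelx := congrArg (eval (℘[L] z)) hrel
    simp only [eval_mul, h0, mul_zero] at hrelx
    have hP0 : (f₀.map (algebraMap ℝ ℂ)).eval (℘[L] z) = 0 := by
      rcases mul_eq_zero.mp hrelx.symm with h' | h'
      · exact h'
      · exact absurd h' (hQ z hz)
    obtain ⟨a, b, hab⟩ := (isCoprime_map (algebraMap ℝ ℂ)).mpr hcop
    have h1 := congrArg (eval (℘[L] z)) hab
    simp only [eval_add, eval_mul, hP0, h0, mul_zero, add_zero, eval_one] at h1
    exact zero_ne_one h1
  have hPQ₀ : ∀ z ∉ L''.lattice, ℘[L''] z * (g₀.map (algebraMap ℝ ℂ)).eval (℘[L] z) =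
      (f₀.map (algebraMap ℝ ℂ)).eval (℘[L] z) := by
    intro z hz
    have hrelx := congrArg (eval (℘[L] z)) hrel
    simp only [eval_mul] at hrelx
    have h1 := hPQ z hz
    refine mul_right_cancel₀ (hQ z hz) ?_
    linear_combination (g₀.map (algebraMap ℝ ℂ)).eval (℘[L] z) * h1 + hrelx
  -- `deg g₀ < deg f₀`
  have hdeg : g₀.natDegree < f₀.natDegree := by
    have h := L.natDegree_lt_of_weierstrassP_mul_eval_eq L'' (hg₀m.map (algebraMap ℝ ℂ)).ne_zero
      hPQ₀
    rwa [natDegree_map_eq_of_injective hinj, natDegree_map_eq_of_injective hinj] at h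
  -- the transformation identity in `ℂ[X]`, pulled back to `ℝ[X]` and divided by `4`
  have hid := L.transformation_polynomial_identity L'' hle hPQ₀
  rw [hL2, hL3, hg₂, hg₃] at hid
  simp only [derivative_map, C_mul, C_neg, C_pow, map_ofNat] at hid
  have hidR : (derivative f₀ * g₀ - f₀ * derivative g₀) ^ 2 * (X ^ 3 + C α * X + C β) =
      g₀ * (f₀ ^ 3 + C ν ^ 4 * C α' * f₀ * g₀ ^ 2 + C ν ^ 6 * C β' * g₀ ^ 3) := by
    apply mul_left_cancel₀ (by norm_num : (4 : ℝ[X]) ≠ 0)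
    apply Polynomial.map_injective (algebraMap ℝ ℂ) hinj
    simp only [Polynomial.map_mul, Polynomial.map_add, Polynomial.map_sub, Polynomial.map_pow,
      Polynomial.map_C, Polynomial.map_X, Polynomial.map_ofNat, Complex.coe_algebraMap]
    linear_combination hid
  -- the datum `f = f₀`, `g = ν² g₀`, `c = ν`
  have hW₀ : derivative f₀ * g₀ - f₀ * derivative g₀ ≠ 0 := wronskian_ne_zero hcop hdeg
  have hW : derivative f₀ * (C (ν ^ 2) * g₀) - f₀ * (C (ν ^ 2) * derivative g₀) =
      C (ν ^ 2) * (derivative f₀ * g₀ - f₀ * derivative g₀) := by ring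
  refine ⟨f₀, C (ν ^ 2) * g₀, ν, hf₀a, fun n ↦ ?_, hνR, ?_, ?_⟩
  · rw [coeff_C_mul]
    exact (hνR.pow 2).mul (hg₀a n)
  · rw [derivative_C_mul, hW]
    exact mul_ne_zero (C_ne_zero.mpr (pow_ne_zero 2 hν)) hW₀
  · rw [derivative_C_mul, hW, C_pow]
    linear_combination (-(C ν ^ 4)) * hidR

end Summit.KontsevichZagierPeriods.IsogenyCertificates.AlgRealPeriodCell.DatumOfRealMult

end
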